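import Literature.NumberTheory.PAdicHodge.BdRPeriodRingData
import HarnessLib

/-!
# From a de Rham period vector to a semi-invariant vector in `ℂ_F`

`Proofs`-style file (theorems only: no definition, no named fact, no instance).

**What is printed.**  Fontaine, *Le corps des périodes p-adiques* (Astérisque 223, Exp. II), §1.5:
`B_dR⁺` is a complete discrete valuation ring with uniformiser `u = [ε] - 1` (or `ξ`, or `t`), residue
field `ℂ_F` through `θ`, and `σ(u) = k_σ u` with `θ(k_σ) = χ(σ)` the cyclotomic character (§1.5.4);
the graded pieces of `B_dR` are `ℂ_F(i)`.  Consequently (the first step of "de Rham ⟹ Hodge–Tate",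
Fontaine Exp. III §1.5, Fontaine–Ouyang Thm. 5.2.6 for the rank-one invariant case, tree
`exists_unit_of_forall_smul_eq`): a `Γ_F`-stable line — more generally a vector of periods on which
`Γ_F` acts through scalar matrices fixed by `Γ_F` — has a LEADING TERM in `ℂ_F` on which `Γ_F` acts
through the same matrices twisted by a power of the cyclotomic character.

**What is proved here** (`exists_ne_zero_forall_smul_theta_eq`): for a finite index type `κ`, matrices
`A σ ∈ M_κ(F)` and a nonzero vector `β : κ → B_dR(F)` with `σ • β_k = Σ_j A σ_{kj} β_j` for all
`σ ∈ Γ_F`, there are `m ∈ ℤ` and a nonzero `x : κ → ℂ_F` with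
`σ • x_k = χ(σ)^{-m} Σ_j A σ_{kj} x_j`.  Proof: write the nonzero coordinates `β_k = u^{m_k} w_k` with
`w_k ∈ (B_dR⁺)ˣ` (`exists_eq_uBdR_zpow_mul`), let `m = min_k m_k`, `b_k = u^{m_k - m} w_k ∈ B_dR⁺` (so
`b = u^{-m} β` and `θ(b_{k₀}) ≠ 0` at a minimising `k₀`, `isUnit_iff_thetaBdR_ne_zero`), transport the
relation to `b` using `σ(u) = k_σ u` (`exists_galBdRPlus_uBdR_eq_mul_cyclotomic`), pull it back to
`B_dR⁺` (`algebraMap_fracBdR_injective`) and apply `θ` (`thetaBdR_galBdRPlus`, `thetaBdR_embBdRHom`).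
No filtration, grading or Hodge–Tate weight enters: only the valuation of `B_dR⁺` and `θ`.

## References

* J.-M. Fontaine, *Le corps des périodes p-adiques*, Astérisque 223 (1994), Exp. II §1.5.2–1.5.5.
  [`FontaineAsterisque223III`]
* J.-M. Fontaine, Y. Ouyang, *Theory of p-adic Galois representations* (2022 draft), Prop. 5.1.4,
  Thm. 5.2.6.  [`FontaineOuyang2022`]
-/

noncomputable section

open ValuativeRel Field Ideal WittVector

namespace Literature.NumberTheory.PAdicHodge

open Literature.NumberTheory.GaloisRepresentations
open Literature.NumberTheory.GaloisRepresentations.IsNonarchimedeanLocalField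

namespace BdRPeriodVector

variable {F : Type} [Field F] [ValuativeRel F] [TopologicalSpace F] [IsNonarchimedeanLocalField F]
  [CharZero F] {p : ℕ} [Fact p.Prime] [Fact (¬ IsUnit (p : integerC F))]
  [IsAdicComplete (Ideal.span {(p : integerC F)}) (integerC F)]
  (hp : valuation F p < 1) (hF : Function.Surjective (fontaineTheta (integerC F) p))
  [IsDomain (BDeRhamPlus (integerC F) p)]

include hF in
/-- `u ≠ 0` in `B_dR(F)` (`u = ξ v` with `v` a unit and `ξ ≠ 0`). [folklore] -/
private theorem algebraMap_uBdR_ne_zero :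
    algebraMap (BDeRhamPlus (integerC F) p) (FracBdR F p) uBdR ≠ 0 := by
  obtain ⟨v, hv, huv⟩ := exists_uBdR_eq_xiBdR_mul (F := F) (p := p) hF
  rw [huv, map_mul]
  exact mul_ne_zero (algebraMap_xiBdR_ne_zero hF)
    ((map_ne_zero_iff _ algebraMap_fracBdR_injective).2 hv.ne_zero)

include hF in
/-- **Clearing denominators uniformly**: for a vector `β : κ → B_dR(F)`, `β ≠ 0`, there are `m ∈ ℤ`
and `b : κ → B_dR⁺(F)` with `b_k = u^{-m} β_k` for all `k` and `θ(b_{k₀}) ≠ 0` for some `k₀`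
(`m` = the minimum of the `u`-adic valuations of the nonzero coordinates, Fontaine Exp. II §1.5.5:
`B_dR⁺` is a discrete valuation ring with uniformiser `u` and residue map `θ`).
[cite: FontaineAsterisque223III, Exp. II §1.5.5] [cite: FontaineOuyang2022, Prop. 5.1.4] -/
theorem exists_int_forall_algebraMap_eq_uBdR_zpow_mul {κ : Type} [Fintype κ]
    {β : κ → FracBdR F p} (hβ0 : β ≠ 0) :
    ∃ (m : ℤ) (b : κ → BDeRhamPlus (integerC F) p),
      (∀ k, algebraMap (BDeRhamPlus (integerC F) p) (FracBdR F p) (b k) =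
        algebraMap (BDeRhamPlus (integerC F) p) (FracBdR F p) uBdR ^ (-m) * β k) ∧
      ∃ k₀, thetaBdR (b k₀) ≠ 0 := by
  classical
  set a := algebraMap (BDeRhamPlus (integerC F) p) (FracBdR F p) with ha
  have hu0 : a uBdR ≠ 0 := algebraMap_uBdR_ne_zero hF
  -- `u`-adic decomposition of the nonzero coordinates
  have hdec : ∀ k, ∃ (n : ℤ) (w : (BDeRhamPlus (integerC F) p)ˣ), β k ≠ 0 →
      β k = a uBdR ^ n * a (w : BDeRhamPlus (integerC F) p) := by
    intro k
    by_cases hk : β k = 0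
    · exact ⟨0, 1, fun h => (h hk).elim⟩
    · obtain ⟨n, w, hw⟩ := exists_eq_uBdR_zpow_mul hF hk
      exact ⟨n, w, fun _ => hw⟩
  choose n w hnw using hdec
  -- the support and the minimal valuation
  set S : Finset κ := Finset.univ.filter fun k => β k ≠ 0 with hS
  have hSne : S.Nonempty := by
    obtain ⟨k, hk⟩ := Function.ne_iff.mp hβ0
    exact ⟨k, by simpa [hS] using hk⟩
  obtain ⟨k₀, hk₀S, hk₀⟩ := Finset.exists_mem_eq_inf' hSne n
  set m : ℤ := S.inf' hSne n with hm
  have hmin : ∀ k, β k ≠ 0 → m ≤ n k := fun k hk =>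
    Finset.inf'_le n (by simp [hS, hk])
  have hβk₀ : β k₀ ≠ 0 := by simpa [hS] using hk₀S
  -- the integral vector `b = u^{-m} β`
  refine ⟨m, fun k => if hk : β k ≠ 0 then uBdR ^ (n k - m).toNat * (w k : BDeRhamPlus (integerC F) p)
    else 0, fun k => ?_, k₀, ?_⟩
  · beta_reduce
    by_cases hk : β k ≠ 0
    · have hn : ((n k - m).toNat : ℤ) = n k - m := Int.toNat_of_nonneg (sub_nonneg.2 (hmin k hk))
      rw [dif_pos hk, map_mul, map_pow, ← zpow_natCast, hn, hnw k hk, ← mul_assoc, ← zpow_add₀ hu0]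
      congr 2
      ring
    · rw [dif_neg hk, not_not.mp hk, map_zero, mul_zero]
  · beta_reduce
    have hn0 : (n k₀ - m).toNat = 0 := by rw [← hk₀, sub_self]; rfl
    rw [dif_pos hβk₀, hn0, pow_zero, one_mul]
    exact (isUnit_iff_thetaBdR_ne_zero hF _).1 (w k₀).isUnit

include hp hF in
/-- **Leading term of a semi-invariant period vector.**  Let `A σ ∈ M_κ(F)` (`σ ∈ Γ_F`) and let
`β : κ → B_dR(F)` be a nonzero vector with `σ • β_k = Σ_j A σ_{kj} · β_j` for all `σ, k` (the
entries of `A σ` embedded through `F ↪ B_dR⁺ ⊆ B_dR`).  Then for some `m ∈ ℤ` there is a nonzero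
`x : κ → ℂ_F` with `σ • x_k = χ(σ)^{-m} Σ_j A σ_{kj} · x_j`, `χ` the `p`-adic cyclotomic character
(viewed in `ℂ_F` through `ℤ_p ⊆ ℚ_p → F → ℂ_F`): namely `x = θ(u^{-m} β)` for `m` the minimal
`u`-adic valuation of the coordinates of `β`, using `σ(u) = k_σ u`, `θ(k_σ) = χ(σ)`.  This is the
passage from de Rham periods to Hodge–Tate (here: Tate–Sen) periods, in coordinates and without the
filtration. [cite: FontaineAsterisque223III, Exp. II §1.5.4–1.5.5] [cite: FontaineOuyang2022, Thm. 5.2.6] -/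
theorem exists_ne_zero_forall_smul_theta_eq {κ : Type} [Fintype κ]
    (A : absoluteGaloisGroup F → Matrix κ κ F) {β : κ → FracBdR F p} (hβ0 : β ≠ 0)
    (hβ : ∀ σ k, σ • β k =
      ∑ j, algebraMap (BDeRhamPlus (integerC F) p) (FracBdR F p) (embBdRHom hp hF (A σ k j)) * β j) :
    ∃ (m : ℤ) (x : κ → CompletedAlgClosure F), x ≠ 0 ∧
      ∀ σ k, σ • x k =
        (algebraMap F (CompletedAlgClosure F)
          (LocalField.padicRingHom F p hp
            (((GaloisRep.cyclotomicCharacter F p σ : ℤ_[p]ˣ) : ℤ_[p]) : ℚ_[p]))) ^ (-m) *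
          ∑ j, algebraMap F (CompletedAlgClosure F) (A σ k j) * x j := by
  classical
  set a := algebraMap (BDeRhamPlus (integerC F) p) (FracBdR F p) with ha
  have hu0 : a uBdR ≠ 0 := algebraMap_uBdR_ne_zero hF
  obtain ⟨m, b, hb, k₀, hk₀⟩ := exists_int_forall_algebraMap_eq_uBdR_zpow_mul hF hβ0
  refine ⟨m, fun k => thetaBdR (b k), fun h => hk₀ (by simpa using congrFun h k₀), fun σ k => ?_⟩
  -- `σ(u) = k_σ u`, `θ(k_σ) = χ(σ)`, `k_σ` a unit
  obtain ⟨kσ, hkσ, hθk⟩ := exists_galBdRPlus_uBdR_eq_mul_cyclotomic hp hF σ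
  have hkunit : IsUnit kσ := by
    rw [isUnit_iff_thetaBdR_ne_zero hF, hθk, map_ne_zero_iff _ (algebraMap F (CompletedAlgClosure F)).injective,
      map_ne_zero_iff _ (LocalField.padicRingHom F p hp).injective]
    exact PadicInt.coe_ne_zero.2 (GaloisRep.cyclotomicCharacter F p σ).ne_zero
  -- `σ • a(u)^{-m} = a(k_σ)^{-m} a(u)^{-m}`
  have hσu : σ • (a uBdR ^ (-m)) = (a kσ * a uBdR) ^ (-m) := by
    rw [smul_fracBdR_eq_toRingHom σ (_ ^ (-m)), map_zpow₀, ← smul_fracBdR_eq_toRingHom, ha,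
      smul_algebraMap_fracBdR, hkσ, map_mul]
  -- the relation for `b`, in `B_dR`
  have h1 : σ • a (b k) = a kσ ^ (-m) * ∑ j, a (embBdRHom hp hF (A σ k j)) * a (b j) := by
    rw [hb k, smul_mul', hσu, hβ σ k, mul_zpow, mul_assoc]
    congr 1
    rw [Finset.mul_sum]
    exact Finset.sum_congr rfl fun j _ => by rw [hb j]; ring
  -- pulled back to `B_dR⁺`
  have h2 : galBdRPlus σ (b k) =
      ((hkunit.unit ^ (-m) : (BDeRhamPlus (integerC F) p)ˣ) : BDeRhamPlus (integerC F) p) *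
        ∑ j, embBdRHom hp hF (A σ k j) * b j := by
    apply algebraMap_fracBdR_injective (F := F) (p := p)
    rw [← ha, ← smul_algebraMap_fracBdR, ← ha] at *
    rw [h1, map_mul, ringHom_units_zpow, IsUnit.unit_spec, map_sum]
    simp only [map_mul]
  -- apply `θ`
  have h3 := congrArg thetaBdR h2
  rw [thetaBdR_galBdRPlus, map_mul, ringHom_units_zpow, IsUnit.unit_spec, hθk, map_sum] at h3
  simp only [map_mul, thetaBdR_embBdRHom] at h3
  exact h3

end BdRPeriodVector

end Literature.NumberTheory.PAdicHodge

end
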